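import Summits.AtomisticToContinuum.Crystallization.Theorems.ChartedZeroExcessLayeredLatticeLiouvilleE

/-!
# ChartedZeroExcessLayered · LatticeLiouville — part F/8: §D′ P♭ the declared residual, §D″ the columns of record (decomp-a2c lens-2 g24 `LatticeLiouville.lean` v8 sha256 4defadc6…, lines 1323–1431,
split at the `##` / `###` doc-heading boundaries for the gate's 400-line limit (cut table of critic row 444, §C cut once more at §C‴); content byte-identical; ONE
namespace `…Theorems.ChartedZeroExcessLayeredLatticeLiouville` across the parts, linear import chain.
-/

noncomputable section

open scoped BigOperators InnerProductSpace RealInnerProductSpace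
open MeasureTheory Set Metric
open Summit.AtomisticToContinuum.Crystallization.Theorems.ChartedPlanarOrderRigidityDoor (E3 IsClean IsNash IsCharted VisibleGap PertRegime atomsIn)
open Summit.AtomisticToContinuum.Crystallization.Theorems.ChartedPlanarOrderDensityDichotomy (μS IsSep)
open Summit.AtomisticToContinuum.Crystallization.Theorems.ChartedPlanarOrderMesoCut (IsDoorSet NearHom LayeredHom EnvClose)
open Summit.AtomisticToContinuum.Crystallization.Theorems.OverbindingBudgetLiouvilleDictionary (NearHomBD nearHom_of_nearHomBD)
open Summit.AtomisticToContinuum.Crystallization.Theorems.ChartedPlanarOrderDoorLayered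
  (TwoPeriodic not_twoPeriodic_singleton DoorHomogeneityBD DoorPeriodic PeriodicBulkGapDoor PeriodicBulkGap
   doorPeriodic_of_doorHomogeneityBD gap_and_pert_1_50_of_periodic gap_and_pert_1_50_of_periodic'
   NearHomL2BD CleanScaleCoherenceL2BD FlatnessExactL2BD doorPeriodic_of_L2 cleanScaleCoherenceL2BD_of_large nearHomL2BD_mono Layered)
open Summit.AtomisticToContinuum.Crystallization.Theorems.ChartedPlanarOrderDoorLayeredOsc
  (IsTwoShellAffineGood OscillationImprovement DoorPeriodicOsc doorPeriodic_of_osc doorPeriodicOsc_of_doorPeriodic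
   oscillationImprovement_of_ge)
open Literature.MathematicalPhysics.StatisticalMechanics (triangularVec₁ triangularVec₂)

namespace Summit.AtomisticToContinuum.Crystallization.Theorems.ChartedZeroExcessLayeredLatticeLiouville

/-! ### §D′  P♭ — the declared residual with its aperiodic linearisation input made explicit, and the v8 columns -/

/-- **P♭(Λ, θ, κ) «LinearisedFlatnessLayered Λ θ κ»** — P `LinearisedFlatnessExact` GIVEN BOTH linear certificates: the periodic one
(`LatticeLiouvilleCert`, §B) AND the layered one for every stacking word (`LayeredLiouvilleCert`, §D).  Content = the NONLINEAR ε-regularity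
(linearise the Nash equations at the window's own co-Lipschitz-reindexed layered chart; a non-improving sequence blows up to a bounded-gradient
`layeredKernel`-harmonic field on a clean STABLE layered structure, affine-with-free-layer-constants by the certificate = tangent to the chart
family, contradiction) and the iteration down the scales fed by R's uniform κ.  UNDECIDED · BRIDGE-SHAPED · DECLARED-RESIDUAL of g24 · WEAKER than P
(`linearisedFlatnessLayered_of_exact`); P ⟸ P♭ ∧ L_lay (`linearisedFlatnessExact_of_layered`).  Why it might fail: (a′) the ε-regularity by
compactness may consume the L²-MEAN-gradient Liouville (stronger certificate, same Caccioppoli proof) — then re-type the certificates, not the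
split; (a″) co-Lipschitz re-indexing of the limit structure (support-class); (b) basin: oscillation θ and coherence κ inside the contraction regime
(census CAMP: c_nl ≈ 0.04 at θ ≤ 1/12; κ₀ ≥ 1/64 plausible, untested at rms 1/8).  Cheapest falsifier: as P, plus a clean Nash aperiodic stacking
whose linearised operator has a bounded non-affine harmonic field (⇔ `¬LayeredStable`, census POLYTYPE-BLOCH / CHAIN-MARGIN). -/
def LinearisedFlatnessLayered (Λ θ κ : ℝ) : Prop :=
  LatticeLiouvilleCert → LayeredLiouvilleCert → ∀ δ : ℝ, 0 < δ → ∀ S : Set E3, IsDoorSet δ S →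
    (∀ q ∈ S, IsTwoShellAffineGood θ S q) → (∀ R : ℝ, 0 < R → NearHomL2BD Λ κ 4 S (atomsIn (μS S) 0 R)) → TwoPeriodic Λ S

/-- **P ⟹ P♭** (drop the layered certificate): P♭ is the WEAKER statement. -/
theorem linearisedFlatnessLayered_of_exact {Λ θ κ : ℝ} (h : LinearisedFlatnessExact Λ θ κ) : LinearisedFlatnessLayered Λ θ κ :=
  fun hL _ => h hL

/-- ★ **P ⟸ P♭ ∧ L_lay** — the split of the declared residual (PROVED). -/
theorem linearisedFlatnessExact_of_layered {Λ θ κ : ℝ} (hC : LayeredLiouvilleCert) (h : LinearisedFlatnessLayered Λ θ κ) :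
    LinearisedFlatnessExact Λ θ κ :=
  fun hL => h hL hC

/-- ★ **P ⟸ P♭ ∧ LayeredDecay ∧ LayeredMoments ∧ LayeredCrystalStability** (the residual resolved into typed leaves, PROVED). -/
theorem linearisedFlatnessExact_of_layered_pieces {Λ θ κ : ℝ} (hD : LayeredDecay) (hM : LayeredMoments) (hC : LayeredCrystalStability)
    (h : LinearisedFlatnessLayered Λ θ κ) : LinearisedFlatnessExact Λ θ κ :=
  linearisedFlatnessExact_of_layered (layeredLiouvilleCert_of_pieces hD hM hC) h

/-- lens-3's K_B²♮ gives P♭ outright (through P). -/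
theorem linearisedFlatnessLayered_of_flatnessExact {Λ θ κ : ℝ} (h : FlatnessExactL2BD Λ κ) : LinearisedFlatnessLayered Λ θ κ :=
  linearisedFlatnessLayered_of_exact (linearisedFlatnessExact_of_flatnessExact h)

/-- P♭ is ANTI-monotone in θ and ANTI-monotone in κ. -/
theorem LinearisedFlatnessLayered.anti_anti {Λ θ θ' κ κ' : ℝ} (hθ : θ ≤ θ') (hκ : κ ≤ κ') (h : LinearisedFlatnessLayered Λ θ' κ') :
    LinearisedFlatnessLayered Λ θ κ :=
  fun hL hC δ hδ S hS hO hW => h hL hC δ hδ S hS (fun q hq => (hO q hq).mono hθ) (fun R hR => nearHomL2BD_mono hκ (hW R hR))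

/-- **the seam beneath N″(Λ, θ) with the layered certificate routed in: R ∧ L_lay ∧ P♭ ⟹ N″(Λ, θ)** (PROVED). -/
theorem nonlinearTransferOsc_of_L2_layered {Λ θ κ : ℝ} (hRig : OscRigidityL2BD Λ θ κ) (hC : LayeredLiouvilleCert)
    (hP : LinearisedFlatnessLayered Λ θ κ) : NonlinearTransferOsc Λ θ :=
  nonlinearTransferOsc_of_L2 hRig (linearisedFlatnessExact_of_layered hC hP)

/-- **the full chain at the REGISTRATION literals Λ₀ = 2, θ = 1/16 (bootstrap-free), κ = 1/64 — EIGHT typed Liouville-side leaves: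
L1′♮(2) ⟸ LJDecay ∧ LJMoments ∧ CleanCrystalStability ∧ LayeredDecay ∧ LayeredMoments ∧ LayeredCrystalStability ∧ R(2, 1/16, 1/64) ∧ P♭(2, 1/16, 1/64)**. -/
theorem doorPeriodic_of_layered_pieces_16 (hD : LJDecay) (hM : LJMoments) (hC : CleanCrystalStability)
    (hD' : LayeredDecay) (hM' : LayeredMoments) (hC' : LayeredCrystalStability)
    (hR : OscRigidityL2BD 2 (1 / 16) (1 / 64)) (hP : LinearisedFlatnessLayered 2 (1 / 16) (1 / 64)) : DoorPeriodic 2 :=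
  doorPeriodic_of_pieces hD hM hC ((nonlinearTransferOsc_iff_exact_of_ge le_rfl).1
    (nonlinearTransferOsc_of_L2 hR (linearisedFlatnessExact_of_layered_pieces hD' hM' hC' hP)))

/-- ★ **THE (β) COLUMN OF RECORD, v8 REGISTRATION (θ = 1/16 bootstrap-free, κ = 1/64), RESOLVED INTO TYPED LEAVES** (eight Liouville-side
leaves + HBG″; tree `gap_and_pert_1_50_of_periodic` discharges the door by name):
`LJDecay → LJMoments → CleanCrystalStability → LayeredDecay → LayeredMoments → LayeredCrystalStability → OscRigidityL2BD 2 (1/16) (1/64) →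
LinearisedFlatnessLayered 2 (1/16) (1/64) → PeriodicBulkGapDoor 2 → VisibleGap (1/50) ∧ PertRegime (1/50)`. -/
theorem gap_and_pert_1_50_of_layered_pieces_16 (hD : LJDecay) (hM : LJMoments) (hC : CleanCrystalStability)
    (hD' : LayeredDecay) (hM' : LayeredMoments) (hC' : LayeredCrystalStability)
    (hR : OscRigidityL2BD 2 (1 / 16) (1 / 64)) (hP : LinearisedFlatnessLayered 2 (1 / 16) (1 / 64)) (hG : PeriodicBulkGapDoor 2) :
    VisibleGap (1 / 50) ∧ PertRegime (1 / 50) :=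
  gap_and_pert_1_50_of_periodic (doorPeriodic_of_layered_pieces_16 hD hM hC hD' hM' hC' hR hP) hG

/-- ★ **the same column PACKAGED BY CERTIFICATE — five leaves**: `LatticeLiouvilleCert → LayeredLiouvilleCert → R(2, 1/16, 1/64) → P♭(2, 1/16, 1/64) →
PeriodicBulkGapDoor 2 → VisibleGap (1/50) ∧ PertRegime (1/50)` (the two certificates resolve by `latticeLiouvilleCert_of ∘ latticeLinLiouville_of`
and `layeredLiouvilleCert_of_pieces`). -/
theorem gap_and_pert_1_50_of_certs_16 (hL : LatticeLiouvilleCert) (hL' : LayeredLiouvilleCert) (hR : OscRigidityL2BD 2 (1 / 16) (1 / 64))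
    (hP : LinearisedFlatnessLayered 2 (1 / 16) (1 / 64)) (hG : PeriodicBulkGapDoor 2) : VisibleGap (1 / 50) ∧ PertRegime (1 / 50) :=
  gap_and_pert_1_50_of_periodic
    (doorPeriodic_of hL ((nonlinearTransferOsc_iff_exact_of_ge le_rfl).1 (nonlinearTransferOsc_of_L2_layered hR hL' hP))) hG

/-- ★ **FALLBACK literal θ_osc = 1/32, κ = 1/256 WITH the bootstrap leaf** (nine Liouville-side leaves + HBG″). -/
theorem gap_and_pert_1_50_of_layered_pieces_32 (hD : LJDecay) (hM : LJMoments) (hC : CleanCrystalStability)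
    (hD' : LayeredDecay) (hM' : LayeredMoments) (hC' : LayeredCrystalStability)
    (hR : OscRigidityL2BD 2 (1 / 32) (1 / 256)) (hP : LinearisedFlatnessLayered 2 (1 / 32) (1 / 256))
    (hB : OscillationImprovement (1 / 32)) (hG : PeriodicBulkGapDoor 2) : VisibleGap (1 / 50) ∧ PertRegime (1 / 50) :=
  gap_and_pert_1_50_of_liouville_pieces_L2 hD hM hC hR (linearisedFlatnessExact_of_layered_pieces hD' hM' hC' hP) hB hG

/-! ### §D″ (v8, census TAG 158) — the columns OF RECORD with the shared tolerance honestly placed: R(2, 1/16, κ₁ = 1/16) [rigidity level] ∧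
D(2, 1/16, 1/16, 1/64) [large-scale decay, the N″-core] ∧ P♭(2, 1/16, κ₀ = 1/64) [ε-regularity] ∧ the two Liouville certificates ∧ HBG″ -/

/-- ★★ **COLUMN OF RECORD (v8), resolved form — TEN leaves**: `LJDecay → LJMoments → CleanCrystalStability → LayeredDecay → LayeredMoments →
LayeredCrystalStability → OscRigidityL2BD 2 (1/16) (1/16) → OscFlatnessDecay 2 (1/16) (1/16) (1/64) → LinearisedFlatnessLayered 2 (1/16) (1/64) →
PeriodicBulkGapDoor 2 → VisibleGap (1/50) ∧ PertRegime (1/50)`. -/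
theorem gap_and_pert_1_50_of_layered_pieces_16d (hD : LJDecay) (hM : LJMoments) (hC : CleanCrystalStability)
    (hD' : LayeredDecay) (hM' : LayeredMoments) (hC' : LayeredCrystalStability)
    (hR : OscRigidityL2BD 2 (1 / 16) (1 / 16)) (hDec : OscFlatnessDecay 2 (1 / 16) (1 / 16) (1 / 64))
    (hP : LinearisedFlatnessLayered 2 (1 / 16) (1 / 64)) (hG : PeriodicBulkGapDoor 2) : VisibleGap (1 / 50) ∧ PertRegime (1 / 50) :=
  gap_and_pert_1_50_of_layered_pieces_16 hD hM hC hD' hM' hC' (oscRigidityL2BD_of_decay hR hDec) hP hG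

/-- ★★ **COLUMN OF RECORD (v8), certificate form — SIX leaves**: `LatticeLiouvilleCert → LayeredLiouvilleCert → R(2,1/16,1/16) →
D(2,1/16,1/16,1/64) → P♭(2,1/16,1/64) → HBG″ → VisibleGap (1/50) ∧ PertRegime (1/50)`. -/
theorem gap_and_pert_1_50_of_certs_16d (hL : LatticeLiouvilleCert) (hL' : LayeredLiouvilleCert) (hR : OscRigidityL2BD 2 (1 / 16) (1 / 16))
    (hDec : OscFlatnessDecay 2 (1 / 16) (1 / 16) (1 / 64)) (hP : LinearisedFlatnessLayered 2 (1 / 16) (1 / 64)) (hG : PeriodicBulkGapDoor 2) :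
    VisibleGap (1 / 50) ∧ PertRegime (1 / 50) :=
  gap_and_pert_1_50_of_certs_16 hL hL' (oscRigidityL2BD_of_decay hR hDec) hP hG

/-- ★ **OPTIMISTIC MERGE `_16r`** (if P♭'s basin reaches the rigidity level, D ∧ P♭(1/64) merge into P♭(1/16)): `LatticeLiouvilleCert →
LayeredLiouvilleCert → R(2,1/16,1/16) → P♭(2,1/16,1/16) → HBG″ → VisibleGap (1/50) ∧ PertRegime (1/50)` — FIVE leaves, both halves at κ = 1/16. -/
theorem gap_and_pert_1_50_of_certs_16r (hL : LatticeLiouvilleCert) (hL' : LayeredLiouvilleCert) (hR : OscRigidityL2BD 2 (1 / 16) (1 / 16))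
    (hP : LinearisedFlatnessLayered 2 (1 / 16) (1 / 16)) (hG : PeriodicBulkGapDoor 2) : VisibleGap (1 / 50) ∧ PertRegime (1 / 50) :=
  gap_and_pert_1_50_of_periodic
    (doorPeriodic_of hL ((nonlinearTransferOsc_iff_exact_of_ge le_rfl).1 (nonlinearTransferOsc_of_L2_layered hR hL' hP))) hG

/-- **the decay piece is dischargeable at the FALLBACK rigidity literal κ₁ = 1 as well** (C_rig ≤ 8): `R(2,1/16,1) ∧ D(2,1/16,1,1/64) ⟹ R(2,1/16,1/64)`
— the registered decl `OscFlatnessDecay` serves every κ₁ (the literal only moves the R/D boundary, never P♭). -/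
theorem oscRigidity_64_of_rig_one (hR : OscRigidityL2BD 2 (1 / 16) 1) (hDec : OscFlatnessDecay 2 (1 / 16) 1 (1 / 64)) :
    OscRigidityL2BD 2 (1 / 16) (1 / 64) :=
  oscRigidityL2BD_of_decay hR hDec

end Summit.AtomisticToContinuum.Crystallization.Theorems.ChartedZeroExcessLayeredLatticeLiouville

end
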